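import Summits.AtomisticToContinuum.FouriersLaw.Theorems.BondHeatUncertaintyBoundedResponseParityFloorProof
import Summits.AtomisticToContinuum.FouriersLaw.Theorems.PhononMeanFreePathIncoherentBoundedEnergyStatics
import HarnessLib

/-!
(SPLIT FOR THE 400-LINE CAP by the landing lane, hand-2 g36: this file = part 1 of 2; the sequel `…BondHeatUncertaintyBoundedResponseStorageLeak` imports it; same namespace, all FQNs unchanged.)
# NODE 95E «StorageLeak» (lens-1 g95): the ENERGY BALANCE `W_N = S_N + F_N` and the cut of the residual (D)

Decomposition cell `decomp-a2c`, lens «grading / quantitative ladder», generation 95, beneath the tree nodes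
`…BondHeatUncertaintyBoundedResponseTransientBand{A,B}` ((D) `DeficitCesaroPoint`, the Thouless-time Cesàro deficit
`W_N(cN²) = ∫₀^{cN²}(1 − θ_N) ≤ C·N`; door of record v5: `11071 ⟸ (D) ∧ (K)`), `…ParityFloor` (94P) and
`…ParityFloorProof{A,B,}` (95L: the Kubo correctors `h_b = R₀(p_b² − T)`, detailed balance for the constructed kernels, (L) proved).

## Thesis of this node

(D) is the only phonon-false piece left on lens-1's line and is ≡ 11071 modulo the phonon-true ceiling (U) (row 1330), so a
further cut of (D) must come from a MECHANISM, not from grading.  The mechanism here is the FIRST LAW IN LINEAR RESPONSE: the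
heat `γδ·W_N(t)` injected at the hot contact up to time `t` (after raising `T_L` by `δ` at time `0`, to first order) splits as

  `W_N(t) = S_N(t) + F_N(t)`     (`deficitCesaro_eq_storage_add_leak`, every `N ≥ 2`, `t ≥ 0`, PROVED)

with `S_N(t) = (1/T²)∫₀ᵗ⟨θ₀, P_s(H − ⟨H⟩)⟩_{μ_T} ds` = energy STORED in the chain (`storageResponse`,
`storageResponse_eq_intervalIntegral`) and `F_N(t) = (γ/T²)(∫₀ᵗ⟨θ₀, h_{N−1}⟩ds − ∫₀ᵗ⟨θ₀, P_s h_{N−1}⟩ds)` = heat LEAKED into the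
far bath (`leakResponse`, `leakResponse_eq_intervalIntegral`; `θ_b = p_b² − T`, `h_b = R₀θ_b`, `P_s` the equilibrium semigroup at
`T_L = T_R = T`).  Two by-products, both PROVED at fixed `N`:

* `E_N = (γ/T²)⟨p₀² − T, R₀(p_{N−1}² − T)⟩_{μ_T}` (`escapeDeficit_eq_crossPairing`): the escape deficit of the tree IS the end-to-end
  Kubo transfer coefficient (pair identity `h₀ + h_{N−1} = (H − ⟨H⟩)/γ` a.e. of 95L + the Gaussian moment `⟨(p₀² − T)H⟩ = T²`);
* `escapeTransient_N(t) = (γ/T²)⟨h₀∘Θ, h₀ − P_t h₀⟩` (`escapeTransient_eq_pairing`) and the general increment identity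
  `⟨G∘Θ, h₀ − P_t h₀⟩ = ∫₀ᵗ⟨θ₀, P_s G⟩ds` (`integral_flip_mul_increment_eq`, detailed balance [cite: ReyBellet2006, Lemma 4.2]).

## The cut (D) ⟸ (D_S) ∧ (D_F) and its tags

* (D_S) `StorageBound`: `S_N(t) ≤ C·N` for all `t ≥ 0`, `N ≥ N₀` — thermodynamic (extensive heat capacity, no overshoot), NOT a
  transport statement; PROVED ⟸ (V) `EnergyFluctuationExtensive` ∧ (C₁) `CorrectorGrade 1` (`storageBound_of_grades`, AM–GM +
  `L²`-contraction: `|S_N(t)| ≤ (Var H + 4‖h₀‖²)/(2T²)`).  TRUE-leaning for the harmonic member.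
* (D_F) `LeakPoint`: `F_N(cN²) ≤ C·N` — carries the whole transport content: PROVED `(D_S) ∧ (D_F) ⟹ (D)`
  (`deficitCesaroPoint_of_storageBound_leakPoint`) and `11071 ∧ (U) ∧ (V) ∧ (C₁) ⟹ (D_F)` (`leakPoint_of_boundedResponse`), so
  (D_F) ≡ 11071 modulo the phonon-true pieces {(U), (V), (C₁)} — the NEW RESIDUAL.  FALSE-leaning for the harmonic member
  (ballistic leak `F_N^{harm}(cN²) ≈ cN²·E_∞^{harm}`).
* (C₁) `CorrectorGrade 1` also closes the odd-sector side: `(C_s) ⟹ (O_s)` (`oddSnapshotGrade_of_correctorGrade`), hence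
  `(C₁) ⟹ TransientFloor 1`; so DOOR′ `11071 ⟸ (D_F) ∧ (V) ∧ (C₁)` (`boundedResponse_of_leakPoint_grades`) needs neither (K)
  nor (D_S): ONE transport residual (D_F) + two extensivity statements.  Doors of the older shape: `11071 ⟸ (D_F) ∧ (D_S) ∧ (F₁)`
  (`boundedResponse_of_leakPoint_storageBound_transientFloor`), `11071 ⟸ (D_F) ∧ (D_S) ∧ (L₂) ∧ (K)`
  (`boundedResponse_of_leakPoint_storageBound_snapshotKL`).

Honest limits: nothing here decides (D_F); the value of the cut is that (D_F) is a statement about ONE observable — the far contact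
temperature's integrated linear response, equivalently the cross Kubo pairing `s ↦ ⟨θ₀, P_s h_{N−1}⟩` — to which monotonicity /
positivity tools (coupling of the two contact processes, completely-monotone structure of `R₀` in the harmonic member) can be
pointed, whereas (D) mixes storage and leak.  Refs: [cite: CuneoEckmannHairerReyBellet2018, Thm 2.13] (Harris bound, used via 95L),
[cite: ReyBellet2006, Lemma 4.2] (detailed balance), [cite: KunduDharNarayan2009] (Green–Kubo for the boundary-driven chain),
[cite: MaesNetocny2010, Thm 3.1].  0 sorry; standard axioms; every declaration carries a docstring.
-/

noncomputable section

open MeasureTheory ProbabilityTheory Filter Topology Set Function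
open scoped NNReal ENNReal ContDiff
open Literature.MathematicalPhysics.KineticTheory.HeatConduction
open Literature.MathematicalPhysics.KineticTheory OscillatorChain
open Summit.AtomisticToContinuum.FouriersLaw.Theorems.SubdiffusiveBondHeat
open Summit.AtomisticToContinuum.FouriersLaw.Theorems.OddSectorIrreversibility
open Summit.AtomisticToContinuum.FouriersLaw.Theorems.ExtensiveSnapshotIrreversibility.ClausiusBudget
open Summit.AtomisticToContinuum.FouriersLaw.Theorems.HonestZwanzig
open Summit.AtomisticToContinuum.FouriersLaw.Theorems.BoundedResponse.TransientBand
open Summit.AtomisticToContinuum.FouriersLaw.Cruxes.SuperadditiveResistance.FloatingProbeBypassLaplacian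

namespace Summit.AtomisticToContinuum.FouriersLaw.Theorems.BoundedResponse.ParityFloor

open Summit.AtomisticToContinuum.FouriersLaw.Theses.BondHeatUncertainty (BoundedResponse ExtensiveSnapshotIrreversibility)
open Summit.AtomisticToContinuum.FouriersLaw.Theorems.SubdiffusiveBondHeat.EscapeGrading (OhmicFloor ExponentFloor)
open Summit.AtomisticToContinuum.FouriersLaw.Theorems.BoundedResponse.TransientBand
  (DeficitCesaroPoint TransientFloor TransientCeilingPoint DeficitCesaroGrade)

/-! ## §E Energy balance in linear response: `W_N = S_N + F_N` (injected = stored + leaked), and the cut of (D) -/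

section StorageLeak

open Summit.AtomisticToContinuum.FouriersLaw.Theorems.SubdiffusiveBondHeat.EscapeGrading (escapeDeficit)

variable {ω₂ lam β γ T : ℝ}

/-! ### §E.1 Objects -/

/-- `P_t h_b(z) = ∫ h_b dP_t(z,·)` — the Kubo corrector of the contact observable `θ_b` propagated for time `t⁺` by the
constructed transition kernel at equal bath temperatures `T`. [folklore] -/
def corrAct (ω₂ lam β γ T : ℝ) (N : ℕ) (b : Fin N) (t : ℝ) (z : PhaseSpace N) : ℝ :=
  ∫ y, kinCorrector ω₂ lam β γ T N b y ∂((pinnedChain ω₂ lam β γ).transitionKernel N T T t.toNNReal z)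

/-- **The storage functional `S_N(t) = (1/T²) ∫ (H − ⟨H⟩_T)·(h₀ − P_t h₀) dμ_T`** (junk value `0` at `N = 0`).
Physics: by detailed balance and the shift identity `h₀ − P_t h₀ = ∫₀ᵗ P_s θ₀ ds` this is
`(1/T²)∫₀ᵗ ⟨θ₀, P_s(H − ⟨H⟩)⟩_{μ_T} ds` (`storageResponse_eq_intervalIntegral`), i.e. `γδ·S_N(t)` is the Kubo linear
response at time `t` of the chain's ENERGY to raising the temperature of bath `0` by `δ` at time `0`: the heat STORED in the
chain up to time `t`, per `γδ`. [folklore] -/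
def storageResponse (ω₂ lam β γ T : ℝ) (N : ℕ) (t : ℝ) : ℝ :=
  if h : 0 < N then
    1 / T ^ 2 * ∫ z, ((pinnedChain ω₂ lam β γ).hamiltonian N z -
        ∫ x, (pinnedChain ω₂ lam β γ).hamiltonian N x ∂((pinnedChain ω₂ lam β γ).gibbsMeasure N T)) *
      (kinCorrector ω₂ lam β γ T N ⟨0, h⟩ z - corrAct ω₂ lam β γ T N ⟨0, h⟩ t z)
      ∂((pinnedChain ω₂ lam β γ).gibbsMeasure N T)
  else 0

/-- **The leak functional `F_N(t) = t·E_N − (γ/T²) ∫ h_{N−1}(Θz)·(h₀ − P_t h₀)(z) dμ_T`** (junk value `t` at `N = 0`).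
Physics: `E_N = (γ/T²)⟨θ₀, h_{N−1}⟩_{μ_T}` (`escapeDeficit_eq_crossPairing`: the escape deficit IS the end-to-end Kubo
transfer coefficient) and `∫ h_{N−1}(Θz)(h₀ − P_t h₀)(z) dμ_T = ∫₀ᵗ ⟨θ₀, P_s h_{N−1}⟩ ds` (`integral_flip_mul_increment_eq`), so
`F_N(t) = (γ/T²)·(∫₀ᵗ ⟨θ₀, h_{N−1}⟩ ds − ∫₀ᵗ ⟨θ₀, P_s h_{N−1}⟩ ds)`: the time integral of the linear response of the FAR
contact temperature `p_{N−1}² − T`, i.e. `γδ·F_N(t)` is the heat already passed to the far bath up to time `t`. [folklore] -/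
def leakResponse (ω₂ lam β γ T : ℝ) (N : ℕ) (t : ℝ) : ℝ :=
  if h : 0 < N then
    t * escapeDeficit ω₂ lam β γ T N -
      γ / T ^ 2 * ∫ z, kinCorrector ω₂ lam β γ T N ⟨N - 1, by omega⟩ (z.1, -z.2) *
        (kinCorrector ω₂ lam β γ T N ⟨0, h⟩ z - corrAct ω₂ lam β γ T N ⟨0, h⟩ t z)
        ∂((pinnedChain ω₂ lam β γ).gibbsMeasure N T)
  else t

/-- **The end-to-end kinetic kernel `K×_N(u) = ∫ θ₀ · P_u θ_{N−1} dμ_T = ⟨p₀² − T, P_{u⁺}(p_{N−1}² − T)⟩_{μ_T}`** (junk `0` at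
`N = 0`): the signal a kick of the near contact temperature sends to the FAR contact temperature after time `u`; the Green–Kubo
partner of the tree's `escapeKernel` `K_N(u) = ⟨θ₀, P_u θ₀⟩`. [folklore] -/
def crossKernel (ω₂ lam β γ T : ℝ) (N : ℕ) (u : ℝ) : ℝ :=
  if h : 0 < N then
    ∫ z, kinObs T N ⟨0, h⟩ z * kinAct ω₂ lam β γ T N ⟨N - 1, by omega⟩ u z ∂((pinnedChain ω₂ lam β γ).gibbsMeasure N T)
  else 0

/-! ### §E.2 The pieces (statements over the objects of §E.1) -/

/-- **(D_S) `StorageBound`** — the chain never stores more than `O(N)·δ` of heat: `∃ C N₀ ∀ N ≥ N₀ ∀ t ≥ 0, S_N(t) ≤ C·N`.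
Physics: extensive heat capacity and no temperature overshoot under one-sided heating.  Tags: UNDECIDED · TRUE-leaning for the
harmonic member (Gaussian, `S_N^{harm}(t) ↑ Σ_i ∂_{T_L}⟨e_i⟩/γ = O(N)`) · NOT a transport statement · ⟸ `EnergyFluctuationExtensive
∧ CorrectorGrade 1` (`storageBound_of_grades`). (piece · rung) [route statement · this cell; NOT a literature fact] -/
def StorageBound : Prop :=
  ∀ ω₂ lam β γ : ℝ, 0 < ω₂ → 0 < lam → 0 < β → 0 < γ → ∀ T : ℝ, 0 < T →
    ∃ C : ℝ, ∃ N₀ : ℕ, ∀ N : ℕ, N₀ ≤ N → ∀ t : ℝ, 0 ≤ t → storageResponse ω₂ lam β γ T N t ≤ C * (N : ℝ)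

/-- **(D_F) `LeakPoint`** — by the Thouless time the far bath has received only `O(N)·δ` of heat:
`∃ C, c > 0, N₀: ∀ N ≥ N₀, F_N(cN²) ≤ C·N`.  With (D_S) it gives (D) `DeficitCesaroPoint` (`deficitCesaroPoint_of_storageBound_leakPoint`)
and is implied back by 11071 modulo the phonon-true pieces `TransientCeilingPoint`, `EnergyFluctuationExtensive`, `CorrectorGrade 1`
(`leakPoint_of_boundedResponse`).  Tags: UNDECIDED · FALSE-leaning for the harmonic member (ballistic leak:
`F_N^{harm}(cN²) ≈ cN²·E_∞^{harm} ≫ N`) · carries the transport content of (D) · RESIDUAL. (piece · rung)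
[route statement · this cell; NOT a literature fact] -/
def LeakPoint : Prop :=
  ∀ ω₂ lam β γ : ℝ, 0 < ω₂ → 0 < lam → 0 < β → 0 < γ → ∀ T : ℝ, 0 < T →
    ∃ C c : ℝ, 0 < c ∧ ∃ N₀ : ℕ, ∀ N : ℕ, N₀ ≤ N → leakResponse ω₂ lam β γ T N (c * (N : ℝ) ^ 2) ≤ C * (N : ℝ)

/-- **`CorrectorGrade s` (C_s)** — the graded `L²(μ_T)`-size of the contact Kubo corrector: `∃ C N₀ ∀ N ≥ N₀, ∫ h₀² dμ_T ≤ C·N^s`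
(`h₀ = R₀(p₀² − T)`; `‖h₀‖²` is the `χ²`-rate of the steady state's linear response to heating bath `0`).  `s = 1`:
«the one-sided response is extensive» — implies BOTH `OddSnapshotGrade 1` (`oddSnapshotGrade_of_correctorGrade`, hence
`TransientFloor 1`) AND, with `EnergyFluctuationExtensive`, (D_S).  Tags (`s = 1`): UNDECIDED · TRUE-leaning for the harmonic
member · (K)-class (an extensivity of response, not a conductance statement). (piece · rung)
[route statement · this cell; NOT a literature fact] -/
def CorrectorGrade (s : ℝ) : Prop :=
  ∀ ω₂ lam β γ : ℝ, 0 < ω₂ → 0 < lam → 0 < β → 0 < γ → ∀ T : ℝ, 0 < T →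
    ∃ C : ℝ, ∃ N₀ : ℕ, ∀ (N : ℕ) (hN : 0 < N), N₀ ≤ N →
      ∫ z, kinCorrector ω₂ lam β γ T N ⟨0, hN⟩ z ^ 2 ∂((pinnedChain ω₂ lam β γ).gibbsMeasure N T) ≤ C * (N : ℝ) ^ s

/-- **`EnergyFluctuationExtensive` (V)** — `∃ C ∀ N, Var_{μ_T}(H_N) ≤ C·N` (extensive heat capacity `C_V = Var(H)/T²` of the
finite-range Gibbs chain; standard, e.g. by the transfer operator — typed here as a piece, not imported as a fact).
Tags: KNOWN-IN-PRINT · TRUE for the harmonic member (`Var = N·T²`). (piece) [route statement · this cell; NOT a literature fact] -/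
def EnergyFluctuationExtensive : Prop :=
  ∀ ω₂ lam β γ : ℝ, 0 < ω₂ → 0 < lam → 0 < β → 0 < γ → ∀ T : ℝ, 0 < T →
    ∃ C : ℝ, ∀ N : ℕ, ∫ z, ((pinnedChain ω₂ lam β γ).hamiltonian N z -
        ∫ x, (pinnedChain ω₂ lam β γ).hamiltonian N x ∂((pinnedChain ω₂ lam β γ).gibbsMeasure N T)) ^ 2
        ∂((pinnedChain ω₂ lam β γ).gibbsMeasure N T) ≤ C * (N : ℝ)

/-! ### §E.3 Toolkit at fixed `N`: the weight `ϑ = 1/(4T)`, square-integrability, the increment `h₀ − P_t h₀` -/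

section Pinned

variable {N : ℕ}

/-- The standard weight `ϑ = 1/(4T)` satisfies `0 < ϑ`, `2ϑ < 1/T`, `ϑ < 1/T`. [formal bookkeeping] -/
theorem weight_facts (hT : 0 < T) : (0 : ℝ) < 1 / (4 * T) ∧ 2 * (1 / (4 * T)) < 1 / T ∧ 1 / (4 * T) < 1 / T := by
  have h1 : (0 : ℝ) < 1 / (4 * T) := by positivity
  have h2 : 2 * (1 / (4 * T)) < 1 / T := by
    rw [show 2 * (1 / (4 * T)) = 1 / (2 * T) by ring, one_div_lt_one_div (by positivity) hT]; linarith
  exact ⟨h1, h2, by linarith⟩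

/-- `v_0 = θ_b` (the transition kernel at time `0` is the identity). [folklore] -/
theorem kinAct_zero (hω : 0 < ω₂) (hl : 0 ≤ lam) (hβ : 0 ≤ β) (hγ : 0 ≤ γ) (b : Fin N) (z : PhaseSpace N) :
    kinAct ω₂ lam β γ T N b 0 z = kinObs T N b z := by
  unfold kinAct
  rw [Real.toNNReal_zero, pinnedChain_transitionKernel_zero hω hl hβ hγ, ProbabilityTheory.Kernel.id_apply,
    integral_dirac]

/-- `H² ∈ L¹(μ_T)` and `(H − ⟨H⟩)² ∈ L¹(μ_T)`, with `H − ⟨H⟩` strongly measurable and `|H − ⟨H⟩| ≤ (1/ϑ + |⟨H⟩|)e^{ϑH}` at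
`ϑ = 1/(4T)`. [folklore] -/
theorem centredHamiltonian_facts (hω : 0 < ω₂) (hl : 0 ≤ lam) (hβ : 0 < β) (hγ : 0 < γ) (hN : 0 < N) (hT : 0 < T) :
    StronglyMeasurable (fun z : PhaseSpace N => (pinnedChain ω₂ lam β γ).hamiltonian N z -
        ∫ x, (pinnedChain ω₂ lam β γ).hamiltonian N x ∂((pinnedChain ω₂ lam β γ).gibbsMeasure N T)) ∧
    (∀ y : PhaseSpace N, |(pinnedChain ω₂ lam β γ).hamiltonian N y -
        ∫ x, (pinnedChain ω₂ lam β γ).hamiltonian N x ∂((pinnedChain ω₂ lam β γ).gibbsMeasure N T)| ≤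
      (1 / (1 / (4 * T)) + |∫ x, (pinnedChain ω₂ lam β γ).hamiltonian N x ∂((pinnedChain ω₂ lam β γ).gibbsMeasure N T)|) *
        Real.exp (1 / (4 * T) * (pinnedChain ω₂ lam β γ).hamiltonian N y)) ∧
    Integrable (fun z : PhaseSpace N => ((pinnedChain ω₂ lam β γ).hamiltonian N z -
        ∫ x, (pinnedChain ω₂ lam β γ).hamiltonian N x ∂((pinnedChain ω₂ lam β γ).gibbsMeasure N T)) ^ 2)
      ((pinnedChain ω₂ lam β γ).gibbsMeasure N T) := by
  set P := pinnedChain ω₂ lam β γ with hP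
  obtain ⟨hϑ0, h2ϑ, -⟩ := weight_facts hT
  set m : ℝ := ∫ x, P.hamiltonian N x ∂(P.gibbsMeasure N T) with hm
  have hHc : Continuous (P.hamiltonian N) := pinnedChain_continuous_hamiltonian ω₂ lam β γ N
  have hsm : StronglyMeasurable (fun z : PhaseSpace N => P.hamiltonian N z - m) :=
    (hHc.sub continuous_const).stronglyMeasurable
  have hb : ∀ y : PhaseSpace N, |P.hamiltonian N y - m| ≤
      (1 / (1 / (4 * T)) + |m|) * Real.exp (1 / (4 * T) * P.hamiltonian N y) := fun y => by
    have hH0 : 0 ≤ P.hamiltonian N y := pinnedChain_hamiltonian_nonneg hω.le hl hβ.le γ N y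
    have hHe : P.hamiltonian N y ≤ Real.exp (1 / (4 * T) * P.hamiltonian N y) / (1 / (4 * T)) :=
      IncoherentBounded.hamiltonian_le_exp (γ := γ) hϑ0 y
    have he1 : 1 ≤ Real.exp (1 / (4 * T) * P.hamiltonian N y) := Real.one_le_exp (by positivity)
    calc |P.hamiltonian N y - m| ≤ |P.hamiltonian N y| + |m| := abs_sub _ _
      _ = P.hamiltonian N y + |m| := by rw [abs_of_nonneg hH0]
      _ ≤ Real.exp (1 / (4 * T) * P.hamiltonian N y) / (1 / (4 * T)) +
            |m| * Real.exp (1 / (4 * T) * P.hamiltonian N y) := by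
          gcongr
          exact le_mul_of_one_le_right (abs_nonneg m) he1
      _ = _ := by ring
  exact ⟨hsm, hb, (OddSectorIrreversibility.pinnedChain_integral_sq_act_le_of_stronglyMeasurable hω hl hβ hγ hN hT hϑ0 h2ϑ hsm hb 0).1⟩

/-- **The increment `D_t = h_b − P_t h_b`** (`t ≥ 0`, any contact index `b`): strongly measurable, `D_t = ∫₀ᵗ v_s ds` pointwise,
`D_t² ∈ L¹(μ_T)` and `∫ D_t² dμ_T ≤ 4 ∫ h_b² dμ_T` (`L²`-contraction). [folklore] -/
theorem increment_facts (hω : 0 < ω₂) (hl : 0 ≤ lam) (hβ : 0 < β) (hγ : 0 < γ) (hN : 0 < N) (hT : 0 < T)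
    (b : Fin N) {t : ℝ} (ht : 0 ≤ t) :
    StronglyMeasurable (fun z => kinCorrector ω₂ lam β γ T N b z - corrAct ω₂ lam β γ T N b t z) ∧
    (∀ z, kinCorrector ω₂ lam β γ T N b z - corrAct ω₂ lam β γ T N b t z =
      ∫ s in Ioc (0 : ℝ) t, kinAct ω₂ lam β γ T N b s z) ∧
    Integrable (fun z => (kinCorrector ω₂ lam β γ T N b z - corrAct ω₂ lam β γ T N b t z) ^ 2)
      ((pinnedChain ω₂ lam β γ).gibbsMeasure N T) ∧
    ∫ z, (kinCorrector ω₂ lam β γ T N b z - corrAct ω₂ lam β γ T N b t z) ^ 2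
        ∂((pinnedChain ω₂ lam β γ).gibbsMeasure N T) ≤
      4 * ∫ z, kinCorrector ω₂ lam β γ T N b z ^ 2 ∂((pinnedChain ω₂ lam β γ).gibbsMeasure N T) := by
  set P := pinnedChain ω₂ lam β γ with hP
  obtain ⟨hϑ0, h2ϑ, hϑ1⟩ := weight_facts hT
  obtain ⟨K, c, hK, hc, hb⟩ := harrisBound_exists hω hl hβ hγ hN hT hϑ0 hϑ1
  have hbm : StronglyMeasurable (kinCorrector ω₂ lam β γ T N b) :=
    stronglyMeasurable_kinCorrector hω hl hβ.le hγ.le T b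
  have hpm : StronglyMeasurable (corrAct ω₂ lam β γ T N b t) :=
    hbm.integral_kernel (κ := P.transitionKernel N T T t.toNNReal)
  obtain ⟨hb2, hp2, hcontr⟩ := OddSectorIrreversibility.pinnedChain_integral_sq_act_le_of_stronglyMeasurable hω hl hβ hγ hN hT hϑ0 h2ϑ hbm
    (fun y => abs_kinCorrector_le hω hl hβ hγ hT hϑ0 hb hc b y) t.toNNReal
  have hshift : ∀ z, kinCorrector ω₂ lam β γ T N b z - corrAct ω₂ lam β γ T N b t z =
      ∫ s in Ioc (0 : ℝ) t, kinAct ω₂ lam β γ T N b s z := fun z => by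
    rw [corrAct, act_kinCorrector_eq hω hl hβ hγ hN hT hϑ0 h2ϑ hK.le hb hc b ht z,
      intervalIntegral.integral_of_le ht]
    ring
  have hD2 : Integrable (fun z => (kinCorrector ω₂ lam β γ T N b z - corrAct ω₂ lam β γ T N b t z) ^ 2)
      (P.gibbsMeasure N T) := by
    refine ((hb2.const_mul 2).add (hp2.const_mul 2)).mono' ((hbm.sub hpm).aestronglyMeasurable.pow 2)
      (Eventually.of_forall fun z => ?_)
    rw [Real.norm_eq_abs, abs_of_nonneg (sq_nonneg _), Pi.add_apply]
    simp only [corrAct]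
    nlinarith [sq_nonneg (kinCorrector ω₂ lam β γ T N b z +
      ∫ y, kinCorrector ω₂ lam β γ T N b y ∂(P.transitionKernel N T T t.toNNReal z))]
  refine ⟨hbm.sub hpm, hshift, hD2, ?_⟩
  calc ∫ z, (kinCorrector ω₂ lam β γ T N b z - corrAct ω₂ lam β γ T N b t z) ^ 2 ∂(P.gibbsMeasure N T)
      ≤ ∫ z, (2 * kinCorrector ω₂ lam β γ T N b z ^ 2 +
          2 * (∫ y, kinCorrector ω₂ lam β γ T N b y ∂(P.transitionKernel N T T t.toNNReal z)) ^ 2)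
          ∂(P.gibbsMeasure N T) := by
        refine integral_mono hD2 ((hb2.const_mul 2).add (hp2.const_mul 2)) fun z => ?_
        simp only [corrAct]
        nlinarith [sq_nonneg (kinCorrector ω₂ lam β γ T N b z +
          ∫ y, kinCorrector ω₂ lam β γ T N b y ∂(P.transitionKernel N T T t.toNNReal z))]
    _ = 2 * ∫ z, kinCorrector ω₂ lam β γ T N b z ^ 2 ∂(P.gibbsMeasure N T) +
          2 * ∫ z, (∫ y, kinCorrector ω₂ lam β γ T N b y ∂(P.transitionKernel N T T t.toNNReal z)) ^ 2
            ∂(P.gibbsMeasure N T) := by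
        rw [integral_add (hb2.const_mul 2) (hp2.const_mul 2), integral_const_mul, integral_const_mul]
    _ ≤ _ := by linarith

/-- **Square-integrability of the correctors**: `h_b` is strongly measurable with `h_b² ∈ L¹(μ_T)`, and so is `h_b∘Θ`.
[folklore] -/
theorem corrector_sq_facts (hω : 0 < ω₂) (hl : 0 ≤ lam) (hβ : 0 < β) (hγ : 0 < γ) (hN : 0 < N) (hT : 0 < T)
    (b : Fin N) :
    StronglyMeasurable (kinCorrector ω₂ lam β γ T N b) ∧
    Integrable (fun z => kinCorrector ω₂ lam β γ T N b z ^ 2) ((pinnedChain ω₂ lam β γ).gibbsMeasure N T) ∧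
    StronglyMeasurable (fun z : PhaseSpace N => kinCorrector ω₂ lam β γ T N b (z.1, -z.2)) ∧
    Integrable (fun z : PhaseSpace N => kinCorrector ω₂ lam β γ T N b (z.1, -z.2) ^ 2)
      ((pinnedChain ω₂ lam β γ).gibbsMeasure N T) := by
  set P := pinnedChain ω₂ lam β γ with hP
  obtain ⟨hϑ0, h2ϑ, hϑ1⟩ := weight_facts hT
  obtain ⟨K, c, hK, hc, hb⟩ := harrisBound_exists hω hl hβ hγ hN hT hϑ0 hϑ1
  have hbm : StronglyMeasurable (kinCorrector ω₂ lam β γ T N b) :=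
    stronglyMeasurable_kinCorrector hω hl hβ.le hγ.le T b
  have hb2 := (OddSectorIrreversibility.pinnedChain_integral_sq_act_le_of_stronglyMeasurable hω hl hβ hγ hN hT hϑ0 h2ϑ hbm (fun y => abs_kinCorrector_le hω hl hβ hγ hT hϑ0 hb hc b y) 0).1
  exact ⟨hbm, hb2, hbm.comp_measurable (measurable_fst.prodMk measurable_snd.neg),
    integrable_flip_gibbsMeasure P N T (F := fun y => kinCorrector ω₂ lam β γ T N b y ^ 2) hb2⟩

/-- `θ_b` is strongly measurable with `θ_b² ∈ L¹(μ_T)`. [folklore] -/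
theorem kinObs_sq_facts (hω : 0 < ω₂) (hl : 0 ≤ lam) (hβ : 0 < β) (hγ : 0 < γ) (hN : 0 < N) (hT : 0 < T)
    (b : Fin N) :
    StronglyMeasurable (kinObs T N b) ∧
    Integrable (fun z => kinObs T N b z ^ 2) ((pinnedChain ω₂ lam β γ).gibbsMeasure N T) := by
  obtain ⟨hϑ0, h2ϑ, -⟩ := weight_facts hT
  exact ⟨(continuous_kinObs T b).stronglyMeasurable, (OddSectorIrreversibility.pinnedChain_integral_sq_act_le_of_stronglyMeasurable hω hl hβ hγ hN hT hϑ0 h2ϑ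
    (continuous_kinObs T b).stronglyMeasurable (fun y => abs_kinObs_le (γ := γ) hω hl hβ.le hT.le hϑ0 b y) 0).1⟩

/-! ### §E.4 Identities I: the transient as a corrector pairing; `E_N` as the end-to-end Kubo coefficient -/

/-- **The transient is a corrector pairing**: for `t ≥ 0`,
`escapeTransient_N(t) = (γ/T²) ∫ h₀(Θz)·(h₀(z) − P_t h₀(z)) dμ_T` (`integral_transient_eq`, `integral_tail_eq`). [folklore] -/
theorem escapeTransient_eq_pairing (hω : 0 < ω₂) (hl : 0 < lam) (hβ : 0 < β) (hγ : 0 < γ) (hN : 0 < N) (hT : 0 < T)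
    {t : ℝ} (ht : 0 ≤ t) :
    escapeTransient ω₂ lam β γ T N t =
      γ / T ^ 2 * ∫ z, kinCorrector ω₂ lam β γ T N ⟨0, hN⟩ (z.1, -z.2) *
        (kinCorrector ω₂ lam β γ T N ⟨0, hN⟩ z - corrAct ω₂ lam β γ T N ⟨0, hN⟩ t z)
        ∂((pinnedChain ω₂ lam β γ).gibbsMeasure N T) := by
  obtain ⟨hϑ0, h2ϑ, hϑ1⟩ := weight_facts hT
  obtain ⟨K, c, hK, hc, hb⟩ := harrisBound_exists hω hl.le hβ hγ hN hT hϑ0 hϑ1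
  have hKi := integrableOn_escapeKernel hω hl hβ hγ hT N
  have e1 : escapeTransient ω₂ lam β γ T N t =
      γ / T ^ 2 * ∫ s in (0 : ℝ)..t, ∫ u in Ioi 0, escapeKernel ω₂ lam β γ T N (u + s) := by
    rw [← integral_transient_eq hω hl hβ hγ hT N ht, ← intervalIntegral.integral_const_mul]
    refine intervalIntegral.integral_congr fun s hs => ?_
    have hs0 : 0 ≤ s := by
      rw [uIcc_of_le ht] at hs
      exact hs.1
    rw [stepResponse, escapeDeficit_eq, setIntegral_Ioi_comp_add_right (escapeKernel ω₂ lam β γ T N) s,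
      ← intervalIntegral.integral_interval_add_Ioi hKi (hKi.mono_set (Ioi_subset_Ioi hs0))]
    ring
  rw [e1, integral_tail_eq hω hl hβ hγ hN hT hϑ0 h2ϑ hK.le hb hc ht]
  rfl

/-- **The escape deficit is the end-to-end Kubo transfer coefficient**: for `N ≥ 2`,
`E_N = (γ/T²) ∫ θ₀·h_{N−1} dμ_T = (γ/T²)⟨p₀² − T, R₀(p_{N−1}² − T)⟩_{μ_T}` — from `∫_{(0,∞)} K_N = ⟨θ₀, h₀⟩`
(`setIntegral_escapeKernel_add_eq` at `s = 0`), the pair identity `h₀ + h_{N−1} = (H − ⟨H⟩)/γ` a.e.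
(`kinCorrector_pair_ae_eq`) and the Gaussian moment `∫ (p₀² − T)·H dμ_T = T²` (tree). [folklore] -/
theorem escapeDeficit_eq_crossPairing (hω : 0 < ω₂) (hl : 0 < lam) (hβ : 0 < β) (hγ : 0 < γ) (hN : 2 ≤ N)
    (hT : 0 < T) :
    escapeDeficit ω₂ lam β γ T N =
      γ / T ^ 2 * ∫ z, kinObs T N ⟨0, by omega⟩ z * kinCorrector ω₂ lam β γ T N ⟨N - 1, by omega⟩ z
        ∂((pinnedChain ω₂ lam β γ).gibbsMeasure N T) := by
  set P := pinnedChain ω₂ lam β γ with hP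
  have hN0 : 0 < N := by omega
  haveI : IsProbabilityMeasure (P.gibbsMeasure N T) :=
    pinnedChain_isProbabilityMeasure_gibbsMeasure hω hl.le hβ.le γ N hT
  obtain ⟨hϑ0, h2ϑ, hϑ1⟩ := weight_facts hT
  obtain ⟨K, c, hK, hc, hb⟩ := harrisBound_exists hω hl.le hβ hγ hN0 hT hϑ0 hϑ1
  set m : ℝ := ∫ x, P.hamiltonian N x ∂(P.gibbsMeasure N T) with hm
  -- `∫_{(0,∞)} K_N = ∫ θ₀ h₀`
  have hK0 : ∫ u in Ioi 0, escapeKernel ω₂ lam β γ T N u =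
      ∫ z, kinObs T N ⟨0, hN0⟩ z * kinCorrector ω₂ lam β γ T N ⟨0, hN0⟩ z ∂(P.gibbsMeasure N T) := by
    have h0 := setIntegral_escapeKernel_add_eq hω hl hβ hγ hN0 hT hϑ0 h2ϑ hK.le hb hc (le_refl (0 : ℝ))
    simp only [add_zero] at h0
    rw [h0]
    refine integral_congr_ae (Eventually.of_forall fun z => ?_)
    dsimp only
    rw [kinAct_zero hω hl.le hβ.le hγ.le, kinObs_reversal]
  -- integrability of the pairings
  obtain ⟨hθm, hθ2⟩ := kinObs_sq_facts hω hl.le hβ hγ hN0 hT ⟨0, hN0⟩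
  obtain ⟨h0m, h02, -, -⟩ := corrector_sq_facts hω hl.le hβ hγ hN0 hT ⟨0, hN0⟩
  obtain ⟨h1m, h12, -, -⟩ := corrector_sq_facts hω hl.le hβ hγ hN0 hT ⟨N - 1, by omega⟩
  obtain ⟨hHm, -, hH2⟩ := centredHamiltonian_facts hω hl.le hβ hγ hN0 hT
  have i00 := integrable_mul_of_integrable_sq hθm.aestronglyMeasurable h0m.aestronglyMeasurable hθ2 h02
  have i01 := integrable_mul_of_integrable_sq hθm.aestronglyMeasurable h1m.aestronglyMeasurable hθ2 h12
  have i0H := integrable_mul_of_integrable_sq hθm.aestronglyMeasurable hHm.aestronglyMeasurable hθ2 hH2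
  -- the pair identity, paired with `θ₀`
  have hpair := kinCorrector_pair_ae_eq hω hl.le hβ hγ hN hT
  have hsum : (∫ z, kinObs T N ⟨0, hN0⟩ z * kinCorrector ω₂ lam β γ T N ⟨0, hN0⟩ z ∂(P.gibbsMeasure N T)) +
      ∫ z, kinObs T N ⟨0, hN0⟩ z * kinCorrector ω₂ lam β γ T N ⟨N - 1, by omega⟩ z ∂(P.gibbsMeasure N T) =
      T ^ 2 / γ := by
    rw [← integral_add i00 i01]
    have e : ∫ z, (kinObs T N ⟨0, hN0⟩ z * kinCorrector ω₂ lam β γ T N ⟨0, hN0⟩ z +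
        kinObs T N ⟨0, hN0⟩ z * kinCorrector ω₂ lam β γ T N ⟨N - 1, by omega⟩ z) ∂(P.gibbsMeasure N T) =
        ∫ z, 1 / γ * (kinObs T N ⟨0, hN0⟩ z * (P.hamiltonian N z - m)) ∂(P.gibbsMeasure N T) := by
      refine integral_congr_ae ?_
      filter_upwards [hpair] with z hz
      rw [← mul_add, hz]
      ring
    have eH : ∫ z, kinObs T N ⟨0, hN0⟩ z * (P.hamiltonian N z - m) ∂(P.gibbsMeasure N T) = T ^ 2 := by
      have e2 : (fun z => kinObs T N ⟨0, hN0⟩ z * (P.hamiltonian N z - m)) = fun z =>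
          kinObs T N ⟨0, hN0⟩ z * P.hamiltonian N z - m * kinObs T N ⟨0, hN0⟩ z := funext fun z => by ring
      have iθH : Integrable (fun z => kinObs T N ⟨0, hN0⟩ z * P.hamiltonian N z) (P.gibbsMeasure N T) := by
        have := i0H.add ((integrable_kinObs hω hl.le hβ.le hT ⟨0, hN0⟩).const_mul m)
        refine this.congr (Eventually.of_forall fun z => ?_)
        simp only [Pi.add_apply]
        ring
      rw [e2, integral_sub iθH ((integrable_kinObs hω hl.le hβ.le hT ⟨0, hN0⟩).const_mul m), integral_const_mul,
        integral_kinObs hω hl.le hβ.le hT, mul_zero, sub_zero]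
      simp only [kinObs]
      exact IncoherentBounded.integral_kinObs_mul_hamiltonian hω hl.le hβ.le hT ⟨0, hN0⟩
    rw [e, integral_const_mul, eH]
    field_simp
  rw [escapeDeficit_eq, hK0]
  have hT2 : T ^ 2 ≠ 0 := by positivity
  have hγ0 : γ ≠ 0 := hγ.ne'
  have e3 : ∫ z, kinObs T N ⟨0, hN0⟩ z * kinCorrector ω₂ lam β γ T N ⟨N - 1, by omega⟩ z ∂(P.gibbsMeasure N T) =
      T ^ 2 / γ - ∫ z, kinObs T N ⟨0, hN0⟩ z * kinCorrector ω₂ lam β γ T N ⟨0, hN0⟩ z ∂(P.gibbsMeasure N T) := by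
    linarith
  rw [e3]
  field_simp

end Pinned

end StorageLeak

end Summit.AtomisticToContinuum.FouriersLaw.Theorems.BoundedResponse.ParityFloor

end
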